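import Mathlib.Algebra.Polynomial.Bivariate
import Mathlib.Algebra.Polynomial.Derivative
import Mathlib.Algebra.Polynomial.Identities
import Mathlib.Algebra.Polynomial.Roots
import Mathlib.Algebra.Polynomial.Div
import Mathlib.Algebra.Polynomial.Taylor
import Mathlib.LinearAlgebra.FiniteDimensional.Lemmas
import Mathlib.LinearAlgebra.Matrix.ToLin
import HarnessLib

/-!
# A polynomial-time list-decodable binary code (Hirahara 2018, Thm. 4.7), II: Sudan's interpolation and Newton lifting

Topic `Literature/Computability/MetaComplexity`, the ALGEBRA of the outer (Reed–Solomon) layer of the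
decoder of `ListDecodableCode.lean` (S. Hirahara, FOCS 2018 / ECCC TR18-138, Thm. 4.7: "any
standard list-decodable code such as the concatenation of a Reed–Solomon code and an Hadamard code",
decoded by Sudan's algorithm [Sud97]). Everything here is about polynomials over a field `K`
(Mathlib's `K[X]` and bivariate `K[X][Y] = Polynomial (Polynomial K)`, outer variable `Y`), with no
lists or machines:

* `LDC.exists_kernel_vec` — a homogeneous linear system with more unknowns than equations has a
  nonzero solution (rank–nullity; the existence half of Sudan's **interpolation step**);
* `LDC.bivOfCoeffs I J c` — the bivariate polynomial `Σ_{i<I, j<J} c i j Xⁱ Yʲ` of a coefficient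
  table, its coefficients, its values `evalEval`, and its shape (`Y`-degree `< J`, `X`-degrees `< I`);
* `LDC.natDegree_eval_le` — for `Q` of that shape and `deg p ≤ n - 1`,
  `deg Q(X, p(X)) ≤ (I - 1) + (J - 1)(n - 1)`; `LDC.eval_eval_eq_evalEval` (`Q(X,p(X))(β) = Q(β, p(β))`);
  `LDC.eval_eq_zero_of_card_lt` — **Sudan's identity**: if `Q` vanishes at `(β, p(β))` for more
  than that many `β` then `Q(X, p(X)) = 0` [Sud97, Lemma 4 / Arora–Barak Thm. 19.24, proof];
* the ROOT-FINDING step in the advice form used by the tree (instead of factoring `Q`):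
  `LDC.exists_multiplicity` — some `Y`-derivative `Q̃ = ∂_Y^{μ-1} Q` (`1 ≤ μ ≤ deg_Y Q`) still has
  `Q̃(X, p(X)) = 0` but `(∂_Y Q̃)(X, p(X)) ≠ 0` (characteristic `> deg_Y Q`);
  `LDC.exists_eval_ne_zero` — a nonzero polynomial of degree `< |K|` has a non-root `β*`;
  `LDC.newton_step` — **Newton iteration**: if `R(Z, f(Z)) = 0` and `δ := (∂_Y R)(0, f(0)) ≠ 0`
  then each Taylor coefficient of `f` is determined by the previous ones,
  `f_m · δ = -[Z^m] R(Z, f_{<m}(Z))` (`m ≥ 1`), where `f_{<m}` is any polynomial of degree `< m` with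
  the same first `m` coefficients — so the decoder recomputes `p_x` from the advice
  `(μ, β*, p_x(β*))` by shifting `X ↦ β* + Z` with Mathlib's `Polynomial.taylor`
  (`LDC.eval_map_taylor`, `LDC.taylor_neg_taylor`, `LDC.newtonPoly_eq`);
* shape bookkeeping under `∂_Y` and under the shift.

## References

* M. Sudan, *Decoding of Reed Solomon codes beyond the error-correction bound*, J. Complexity 13
  (1997) 180–193, §2 (the interpolation lemma and the identity `Q(x, f(x)) ≡ 0`).
* S. Arora, B. Barak, *Computational Complexity: A Modern Approach*, CUP 2009, §19.3–19.4 and the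
  list decoding of Reed–Solomon codes (Sudan's algorithm) [AroraBarakCC2009].
* S. Hirahara, ECCC TR18-138 (2018), Thm. 4.7 [Hirahara2018].
* J. von zur Gathen, J. Gerhard, *Modern Computer Algebra*, 3rd ed., CUP 2013, §9.4 (Newton
  iteration) — schoolbook; proved here.
-/

namespace Literature.Computability.MetaComplexity

open Polynomial Finset
open scoped Polynomial.Bivariate

namespace LDC

section LinearAlgebra

variable {K : Type*} [Field K]

/-- **More unknowns than equations**: a `P × N` homogeneous linear system over a field with `P < N`
has a nonzero solution (rank–nullity, `LinearMap.ker_ne_bot_of_finrank_lt`). This is the existence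
half of the interpolation step of Sudan's algorithm. [cite: AroraBarakCC2009, §19 (list decoding of
Reed–Solomon codes, "there is a nonzero `Q` … since the number of coefficients exceeds the number of
constraints")] -/
theorem exists_kernel_vec {N P : ℕ} (A : Fin P → Fin N → K) (h : P < N) :
    ∃ w : Fin N → K, w ≠ 0 ∧ ∀ pt, ∑ idx, A pt idx * w idx = 0 := by
  let f : (Fin N → K) →ₗ[K] (Fin P → K) := Matrix.mulVecLin (Matrix.of A)
  have hlt : Module.finrank K (Fin P → K) < Module.finrank K (Fin N → K) := by simpa using h
  have hker : LinearMap.ker f ≠ ⊥ := LinearMap.ker_ne_bot_of_finrank_lt hlt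
  obtain ⟨w, hw, hw0⟩ := (Submodule.ne_bot_iff _).1 hker
  refine ⟨w, hw0, fun pt => ?_⟩
  have := congrFun (LinearMap.mem_ker.1 hw) pt
  simpa [f, Matrix.mulVec, dotProduct] using this

end LinearAlgebra

section Bivariate

variable {K : Type*} [CommRing K]

/-! ### Bivariate polynomials from coefficient tables -/

/-- The row polynomial `Σ_{i<I} c i Xⁱ`. [folklore] -/
noncomputable def rowPoly (I : ℕ) (c : ℕ → K) : K[X] := ∑ i ∈ range I, C (c i) * X ^ i

/-- Coefficients of a row polynomial. [folklore] -/
theorem coeff_rowPoly (I : ℕ) (c : ℕ → K) (i : ℕ) : (rowPoly I c).coeff i = if i < I then c i else 0 := by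
  rw [rowPoly, finsetSum_coeff]
  simp_rw [coeff_C_mul_X_pow]
  rw [sum_ite_eq]
  simp only [mem_range]

/-- A row polynomial has degree `< I`. [folklore] -/
theorem degree_rowPoly_lt (I : ℕ) (c : ℕ → K) : (rowPoly I c).degree < I := by
  rw [rowPoly]
  refine (degree_sum_le _ _).trans_lt ((Finset.sup_lt_iff (WithBot.bot_lt_coe I)).2 fun i hi => ?_)
  exact (degree_C_mul_X_pow_le _ _).trans_lt (WithBot.coe_lt_coe.2 (mem_range.1 hi))

/-- Evaluating a row polynomial. [folklore] -/
theorem eval_rowPoly (I : ℕ) (c : ℕ → K) (β : K) : (rowPoly I c).eval β = ∑ i ∈ range I, c i * β ^ i := by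
  simp [rowPoly, eval_finsetSum]

/-- **The bivariate polynomial of a coefficient table**: `Σ_{j<J} (Σ_{i<I} c i j Xⁱ) Yʲ`. [cite:
AroraBarakCC2009, §19 (the interpolating polynomial `Q(x, y) = Σ Q_{ij} xⁱ yʲ`)] -/
noncomputable def bivOfCoeffs (I J : ℕ) (c : ℕ → ℕ → K) : K[X][Y] :=
  ∑ j ∈ range J, C (rowPoly I fun i => c i j) * Y ^ j

/-- The `Y`-coefficients of `bivOfCoeffs`. [folklore] -/
theorem coeff_bivOfCoeffs (I J : ℕ) (c : ℕ → ℕ → K) (j : ℕ) :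
    (bivOfCoeffs I J c).coeff j = if j < J then rowPoly I (fun i => c i j) else 0 := by
  rw [bivOfCoeffs, finsetSum_coeff]
  simp_rw [coeff_C_mul_X_pow]
  rw [sum_ite_eq]
  simp only [mem_range]

/-- The full coefficient table is read back. [folklore] -/
theorem coeff_coeff_bivOfCoeffs (I J : ℕ) (c : ℕ → ℕ → K) (i j : ℕ) :
    ((bivOfCoeffs I J c).coeff j).coeff i = if i < I ∧ j < J then c i j else 0 := by
  rw [coeff_bivOfCoeffs]
  by_cases hj : j < J
  · rw [if_pos hj, coeff_rowPoly]; simp [hj]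
  · rw [if_neg hj, coeff_zero, if_neg (fun h => hj h.2)]

/-- `bivOfCoeffs` is nonzero as soon as one coefficient in range is. [folklore] -/
theorem bivOfCoeffs_ne_zero {I J : ℕ} {c : ℕ → ℕ → K} {i j : ℕ} (hi : i < I) (hj : j < J) (h : c i j ≠ 0) :
    bivOfCoeffs I J c ≠ 0 := by
  intro h0
  have := coeff_coeff_bivOfCoeffs I J c i j
  rw [h0, coeff_zero, coeff_zero, if_pos ⟨hi, hj⟩] at this
  exact h this.symm

/-- The `Y`-degree of `bivOfCoeffs` is `< J`. [folklore] -/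
theorem degree_bivOfCoeffs_lt (I J : ℕ) (c : ℕ → ℕ → K) : (bivOfCoeffs I J c).degree < J := by
  rw [bivOfCoeffs]
  refine (degree_sum_le _ _).trans_lt ((Finset.sup_lt_iff (WithBot.bot_lt_coe J)).2 fun j hj => ?_)
  exact (degree_C_mul_X_pow_le _ _).trans_lt (WithBot.coe_lt_coe.2 (mem_range.1 hj))

/-- Every `Y`-coefficient of `bivOfCoeffs` has `X`-degree `< I`. [folklore] -/
theorem degree_coeff_bivOfCoeffs_lt (I J : ℕ) (c : ℕ → ℕ → K) (j : ℕ) : ((bivOfCoeffs I J c).coeff j).degree < I := by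
  rw [coeff_bivOfCoeffs]
  split_ifs
  · exact degree_rowPoly_lt _ _
  · rw [degree_zero]; exact WithBot.bot_lt_coe I

/-- **Point values**: `Q(β, v) = Σ_{j<J} Σ_{i<I} c i j βⁱ vʲ` — the linear form in the unknowns
`c i j` whose vanishing at the interpolation points is Sudan's linear system. [cite: AroraBarakCC2009,
§19 (interpolation constraints `Q(aᵢ, bᵢ) = 0`)] -/
theorem evalEval_bivOfCoeffs (I J : ℕ) (c : ℕ → ℕ → K) (β v : K) :
    (bivOfCoeffs I J c).evalEval β v = ∑ j ∈ range J, ∑ i ∈ range I, c i j * β ^ i * v ^ j := by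
  rw [bivOfCoeffs, ← coe_evalEvalRingHom, map_sum]
  refine sum_congr rfl fun j _ => ?_
  rw [map_mul, map_pow, coe_evalEvalRingHom, evalEval_C, evalEval_X, eval_rowPoly, sum_mul]

/-! ### The shape of an interpolating polynomial and the degree of `Q(X, p(X))` -/

/-- `Q` has `Y`-degree `< J` and all `X`-degrees `< I`. [folklore] -/
def HasShape (I J : ℕ) (Q : K[X][Y]) : Prop := Q.degree < J ∧ ∀ j, (Q.coeff j).degree < I

/-- `bivOfCoeffs I J c` has shape `(I, J)`. [folklore] -/
theorem hasShape_bivOfCoeffs (I J : ℕ) (c : ℕ → ℕ → K) : HasShape I J (bivOfCoeffs I J c) :=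
  ⟨degree_bivOfCoeffs_lt I J c, degree_coeff_bivOfCoeffs_lt I J c⟩

/-- **Degree of `Q(X, p(X))`**: for `Q` of shape `(I, J)` and `deg p ≤ n - 1` (with `I, J ≥ 1`),
`deg Q(X, p(X)) ≤ (I - 1) + (J - 1)(n - 1)`. [cite: AroraBarakCC2009, §19 (proof of Sudan's
lemma: "`Q(x, P(x))` is a univariate polynomial of degree at most …")] -/
theorem natDegree_eval_le {I J n : ℕ} {Q : K[X][Y]} (hQ : HasShape I J Q) {p : K[X]} (hp : p.natDegree ≤ n - 1) :
    (Q.eval p).natDegree ≤ (I - 1) + (J - 1) * (n - 1) := by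
  rw [eval_eq_sum, sum_def]
  refine natDegree_sum_le_of_forall_le _ _ fun j hj => ?_
  have hjJ : j < J := by
    have h1 : (j : WithBot ℕ) ≤ Q.degree := le_degree_of_mem_supp j hj
    exact_mod_cast h1.trans_lt hQ.1
  have hcoeff : (Q.coeff j).natDegree ≤ I - 1 := by
    have h2 := hQ.2 j
    rcases eq_or_ne (Q.coeff j) 0 with h0 | h0
    · rw [h0, natDegree_zero]; exact Nat.zero_le _
    · rw [degree_eq_natDegree h0] at h2
      have : (Q.coeff j).natDegree < I := by exact_mod_cast h2
      omega
  calc (Q.coeff j * p ^ j).natDegree ≤ (Q.coeff j).natDegree + (p ^ j).natDegree := natDegree_mul_le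
    _ ≤ (I - 1) + j * (n - 1) := Nat.add_le_add hcoeff (natDegree_pow_le.trans (Nat.mul_le_mul_left j hp))
    _ ≤ (I - 1) + (J - 1) * (n - 1) := Nat.add_le_add_left (Nat.mul_le_mul_right _ (by omega)) _

/-- **`Q(X, p(X))` evaluated at `β` is `Q(β, p(β))`.** [folklore] -/
theorem eval_eval_eq_evalEval (Q : K[X][Y]) (p : K[X]) (β : K) : (Q.eval p).eval β = Q.evalEval β (p.eval β) := by
  have h1 : Q.evalEval β (p.eval β) = Q.eval₂ (evalRingHom β) (evalRingHom β p) := by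
    rw [← eval₂_evalRingHom]; rfl
  rw [h1, eval₂_hom, coe_evalRingHom]

/-- **Sudan's identity**: if `Q(X, p(X))` has degree `< |S|` for a set `S` of field elements at all
of which `Q(β, p(β)) = 0`, then `Q(X, p(X)) = 0` (a nonzero polynomial has at most `deg` roots).
[cite: AroraBarakCC2009, §19 (Sudan's algorithm, "`Q(x, P(x))` has more roots than its degree and
hence is identically zero")] -/
theorem eval_eq_zero_of_card_lt [IsDomain K] {Q : K[X][Y]} {p : K[X]} (S : Finset K)
    (hroots : ∀ β ∈ S, Q.evalEval β (p.eval β) = 0) (hdeg : (Q.eval p).natDegree < S.card) : Q.eval p = 0 := by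
  refine eq_zero_of_natDegree_lt_card_of_eval_eq_zero (Q.eval p) (f := fun s : S => (s : K))
    Subtype.coe_injective (fun s => ?_) (by simpa using hdeg)
  rw [eval_eval_eq_evalEval]
  exact hroots s s.2

/-! ### Multiplicity: passing to a `Y`-derivative -/

/-- Iterated `Y`-derivatives keep the shape. [folklore] -/
theorem HasShape.iterate_derivative {I J : ℕ} {Q : K[X][Y]} (hQ : HasShape I J Q) (k : ℕ) :
    HasShape I J (derivative^[k] Q) := by
  refine ⟨?_, fun j => ?_⟩
  · rcases eq_or_ne (derivative^[k] Q) 0 with h0 | h0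
    · rw [h0, degree_zero]; exact WithBot.bot_lt_coe J
    · have h1 : (derivative^[k] Q).natDegree ≤ Q.natDegree := by
        have := natDegree_iterate_derivative Q k; omega
      have hQ0 : Q ≠ 0 := by rintro rfl; simp at h0
      rw [degree_eq_natDegree h0]
      have h2 := hQ.1
      rw [degree_eq_natDegree hQ0] at h2
      exact_mod_cast lt_of_le_of_lt (by exact_mod_cast h1 : ((derivative^[k] Q).natDegree : WithBot ℕ) ≤ Q.natDegree) h2
  · rw [coeff_iterate_derivative]
    exact (degree_smul_le _ _).trans_lt (hQ.2 _)

/-- The top `Y`-derivative of `Q ≠ 0` is the constant `deg_Y(Q)! · lc_Y(Q)`. [folklore] -/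
theorem iterate_derivative_natDegree_eq_C (Q : K[X][Y]) :
    derivative^[Q.natDegree] Q = C ((Q.natDegree.factorial : K[X]) * Q.leadingCoeff) := by
  ext j
  rw [coeff_iterate_derivative, coeff_C]
  rcases Nat.eq_zero_or_pos j with rfl | hj
  · rw [if_pos rfl, zero_add, Nat.descFactorial_self, nsmul_eq_mul, leadingCoeff]
  · rw [if_neg hj.ne', coeff_eq_zero_of_natDegree_lt (by omega : Q.natDegree < j + Q.natDegree), smul_zero]

/-- **Multiplicity of the root `p`**: if `Q ≠ 0`, `Q(X, p(X)) = 0` and `deg_Y(Q)! ≠ 0` in `K`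
(e.g. `char K > deg_Y Q`), then for some `1 ≤ μ ≤ deg_Y Q` the derivative `Q̃ = ∂_Y^{μ-1} Q` has
`Q̃(X, p(X)) = 0` and `(∂_Y Q̃)(X, p(X)) ≠ 0` — `p` is a SIMPLE `Y`-root of `Q̃`. (This replaces the
factorisation of `Q` in Sudan's algorithm: the decoder is told `μ`.) [folklore] -/
theorem exists_multiplicity [IsDomain K] {Q : K[X][Y]} {p : K[X]} (hQ : Q ≠ 0) (hev : Q.eval p = 0)
    (hchar : (Q.natDegree.factorial : K) ≠ 0) :
    ∃ μ, 1 ≤ μ ∧ μ ≤ Q.natDegree ∧ (derivative^[μ - 1] Q).eval p = 0 ∧ (derivative^[μ] Q).eval p ≠ 0 := by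
  classical
  -- the top derivative does not vanish at `p`
  have htop : (derivative^[Q.natDegree] Q).eval p ≠ 0 := by
    rw [iterate_derivative_natDegree_eq_C, eval_C]
    refine mul_ne_zero ?_ (leadingCoeff_ne_zero.2 hQ)
    have : ((Q.natDegree.factorial : K[X])) = C (Q.natDegree.factorial : K) := by simp
    rw [this, Ne, C_eq_zero]
    exact hchar
  have hdeg : 1 ≤ Q.natDegree := by
    by_contra h
    have h0 : Q.natDegree = 0 := by omega
    rw [h0, Function.iterate_zero, id] at htop
    exact htop hev
  have hex : ∃ k, 1 ≤ k ∧ (derivative^[k] Q).eval p ≠ 0 := ⟨Q.natDegree, hdeg, htop⟩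
  refine ⟨Nat.find hex, (Nat.find_spec hex).1, Nat.find_min' hex ⟨hdeg, htop⟩, ?_, (Nat.find_spec hex).2⟩
  -- the previous derivative vanishes: either it is `Q` itself, or by minimality
  by_contra hne
  rcases Nat.lt_or_ge 1 (Nat.find hex) with hlt | hle
  · have hmin := Nat.find_min hex (m := Nat.find hex - 1) (by omega)
    exact hmin ⟨by omega, hne⟩
  · have h1 : Nat.find hex = 1 := le_antisymm hle (Nat.find_spec hex).1
    rw [h1, Nat.sub_self, Function.iterate_zero, id] at hne
    exact hne hev

/-! ### A good evaluation point -/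

/-- **A nonzero polynomial of degree below the field size has a non-root.** [folklore] -/
theorem exists_eval_ne_zero [IsDomain K] [Fintype K] {h : K[X]} (h0 : h ≠ 0) (hdeg : h.natDegree < Fintype.card K) :
    ∃ β : K, h.eval β ≠ 0 := by
  by_contra hall
  push Not at hall
  exact h0 (eq_zero_of_natDegree_lt_card_of_eval_eq_zero h Function.injective_id hall hdeg)

/-! ### Newton iteration for a simple `Y`-root -/

/-- The constant coefficient of `S(X, g(X))` depends only on `g(0)`: it is `S(0, g(0))`. [folklore] -/
theorem coeff_zero_eval (S : K[X][Y]) (g : K[X]) : (S.eval g).coeff 0 = S.evalEval 0 (g.coeff 0) := by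
  rw [coeff_zero_eq_eval_zero, eval_eval_eq_evalEval, ← coeff_zero_eq_eval_zero]

/-- **Newton step.** Let `R(Z, f(Z)) = 0` and `δ := (∂_Y R)(0, f(0))`. If `g` has degree `< m`
(`m ≥ 1`) and the same first `m` coefficients as `f`, then the next coefficient of `f` satisfies
`f_m · δ = -[Z^m] R(Z, g(Z))`. Proof: `f = g + Z^m t` with `t(0) = f_m`; by the binomial expansion
`0 = R(Z,f) = R(Z,g) + (∂_Y R)(Z,g)·Z^m t + k·Z^{2m}t²`, and `[Z^m]` of the middle term is
`(∂_Y R)(0, g(0))·t(0) = δ f_m`. [cite: AroraBarakCC2009, §19 (root finding for `Q(x, y)`; here by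
Newton–Hensel lifting)] -/
theorem newton_step {R : K[X][Y]} {f g : K[X]} {m : ℕ} (hm : 1 ≤ m) (hR : R.eval f = 0)
    (hg : ∀ i < m, g.coeff i = f.coeff i) (hgdeg : g.degree < m) :
    f.coeff m * (derivative R).evalEval 0 (f.coeff 0) = -(R.eval g).coeff m := by
  -- `f = g + X^m * t`
  have hdvd : X ^ m ∣ f - g := X_pow_dvd_iff.2 fun d hd => by rw [coeff_sub, hg d hd, sub_self]
  obtain ⟨t, ht⟩ := hdvd
  have hf : f = g + X ^ m * t := by rw [← ht]; ring
  have hgm : g.coeff m = 0 := coeff_eq_zero_of_degree_lt (lt_of_lt_of_le hgdeg le_rfl)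
  have ht0 : t.coeff 0 = f.coeff m := by
    have := congrArg (fun r => r.coeff m) ht
    simp only [coeff_sub, hgm, sub_zero] at this
    rw [this, coeff_X_pow_mul', if_pos le_rfl, Nat.sub_self]
  -- binomial expansion of `R.eval` around `g`
  obtain ⟨k, hk⟩ := R.binomExpansion g (X ^ m * t)
  rw [← hf, hR] at hk
  have hcoef := congrArg (fun r : K[X] => r.coeff m) hk
  simp only [coeff_zero, coeff_add] at hcoef
  -- the middle term
  have hmid : ((derivative R).eval g * (X ^ m * t)).coeff m = (derivative R).evalEval 0 (f.coeff 0) * f.coeff m := by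
    have e1 : (derivative R).eval g * (X ^ m * t) = ((derivative R).eval g * t) * X ^ m := by ring
    rw [e1, coeff_mul_X_pow', if_pos le_rfl, Nat.sub_self, mul_coeff_zero, coeff_zero_eval, ht0, hg 0 (by omega),
      mul_comm]
  -- the quadratic term vanishes in degree `m < 2m`
  have hquad : (k * (X ^ m * t) ^ 2).coeff m = 0 := by
    have e2 : k * (X ^ m * t) ^ 2 = (k * t ^ 2) * X ^ (2 * m) := by ring
    rw [e2, coeff_mul_X_pow', if_neg (by omega)]
  rw [hmid, hquad, add_zero] at hcoef
  -- `0 = [Z^m] R(Z,g) + δ f_m`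
  linear_combination -hcoef

/-! ### The Taylor shift `X ↦ β + Z` (Mathlib's `Polynomial.taylor`) -/

/-- The shift `X ↦ X + β` of Mathlib (`Polynomial.taylor β p = p.comp (X + C β)`, as the ring
homomorphism `Polynomial.taylorAlgHom β`) applied coefficientwise to a bivariate polynomial commutes
with substitution: `(Q ∘ shift)(Z, (p ∘ shift)(Z)) = (Q(X, p(X))) ∘ shift`. [folklore] -/
theorem eval_map_taylor (Q : K[X][Y]) (p : K[X]) (β : K) :
    (Q.map (taylorAlgHom β : K[X] →+* K[X])).eval (taylor β p) = taylor β (Q.eval p) := by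
  have h : taylor β p = (taylorAlgHom β : K[X] →+* K[X]) p := rfl
  rw [h, eval_map, eval₂_hom]
  rfl

/-- Shifting commutes with `∂_Y`. [folklore] -/
theorem derivative_map_taylor (Q : K[X][Y]) (β : K) :
    derivative (Q.map (taylorAlgHom β : K[X] →+* K[X])) = (derivative Q).map (taylorAlgHom β : K[X] →+* K[X]) :=
  derivative_map Q _

/-- The value at `(0, v)` of the shifted polynomial is the value at `(β, v)` of the original. [folklore] -/
theorem evalEval_zero_map_taylor (Q : K[X][Y]) (β v : K) :
    (Q.map (taylorAlgHom β : K[X] →+* K[X])).evalEval 0 v = Q.evalEval β v := by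
  have hC : (taylorAlgHom β : K[X] →+* K[X]) (C v) = C v := taylor_C β v
  have happ : ∀ r : K[X], (taylorAlgHom β : K[X] →+* K[X]) r = r.comp (X + C β) := fun r => taylor_apply β r
  rw [evalEval, eval_map, ← hC, eval₂_hom, happ, eval_comp]
  simp [evalEval]

/-- The shift preserves the shape of a bivariate polynomial (`Polynomial.degree_taylor`). [folklore] -/
theorem HasShape.map_taylor {I J : ℕ} {Q : K[X][Y]} (hQ : HasShape I J Q) (β : K) :
    HasShape I J (Q.map (taylorAlgHom β : K[X] →+* K[X])) :=
  ⟨(degree_map_le).trans_lt hQ.1, fun j => by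
    rw [coeff_map]
    exact (degree_taylor (Q.coeff j) β).trans_lt (hQ.2 j)⟩

/-- **The inverse shift** (`Polynomial.taylor_taylor`, `Polynomial.taylor_zero`): shifting by `β` and
then by `-β` is the identity. [folklore] -/
theorem taylor_neg_taylor (β : K) (p : K[X]) : taylor (-β) (taylor β p) = p := by
  rw [taylor_taylor, neg_add_cancel, taylor_zero]

/-! ### The Newton sequence -/

/-- The next Taylor coefficient prescribed by Newton's iteration: `a₀` at step `0`, and
`-[Z^m] R(Z, g(Z)) · δ⁻¹` from the current partial polynomial `g` at step `m ≥ 1`. [folklore] -/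
noncomputable def newtonNext (R : K[X][Y]) (a₀ δinv : K) (m : ℕ) (g : K[X]) : K :=
  if m = 0 then a₀ else -((R.eval g).coeff m) * δinv

/-- **The Newton sequence of partial polynomials** `g₀ = 0`, `g_{m+1} = g_m + a_m Z^m`. [folklore] -/
noncomputable def newtonPoly (R : K[X][Y]) (a₀ δinv : K) : ℕ → K[X]
  | 0 => 0
  | m + 1 => newtonPoly R a₀ δinv m + C (newtonNext R a₀ δinv m (newtonPoly R a₀ δinv m)) * X ^ m

/-- The `m`-th partial polynomial has degree `< m`. [folklore] -/
theorem degree_newtonPoly_lt (R : K[X][Y]) (a₀ δinv : K) : ∀ m : ℕ, (newtonPoly R a₀ δinv m).degree < m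
  | 0 => by rw [newtonPoly, degree_zero]; exact WithBot.bot_lt_coe 0
  | m + 1 => by
    rw [newtonPoly]
    refine (degree_add_le _ _).trans_lt (max_lt ((degree_newtonPoly_lt R a₀ δinv m).trans (by exact_mod_cast m.lt_succ_self)) ?_)
    exact (degree_C_mul_X_pow_le _ _).trans_lt (by exact_mod_cast m.lt_succ_self)

/-- Coefficients of the partial polynomials are frozen once set. [folklore] -/
theorem coeff_newtonPoly_of_lt (R : K[X][Y]) (a₀ δinv : K) {i : ℕ} : ∀ {m : ℕ}, i < m →
    (newtonPoly R a₀ δinv m).coeff i = (newtonPoly R a₀ δinv (i + 1)).coeff i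
  | 0, h => absurd h (Nat.not_lt_zero i)
  | m + 1, h => by
    rcases Nat.lt_succ_iff_lt_or_eq.1 h with h' | rfl
    · rw [newtonPoly, coeff_add, coeff_C_mul_X_pow, if_neg h'.ne, add_zero, coeff_newtonPoly_of_lt R a₀ δinv h']
    · rfl

/-- The coefficient set at step `i`. [folklore] -/
theorem coeff_newtonPoly_succ_self (R : K[X][Y]) (a₀ δinv : K) (i : ℕ) :
    (newtonPoly R a₀ δinv (i + 1)).coeff i = newtonNext R a₀ δinv i (newtonPoly R a₀ δinv i) := by
  rw [newtonPoly, coeff_add, coeff_C_mul_X_pow, if_pos rfl,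
    coeff_eq_zero_of_degree_lt (degree_newtonPoly_lt R a₀ δinv i), zero_add]

/-- **Correctness of Newton's iteration**: if `R(Z, f(Z)) = 0`, `δ := (∂_Y R)(0, f(0))` has an
inverse `δinv` (`δ · δinv = 1`), and the iteration is started at `a₀ = f(0)`, then the `m`-th partial
polynomial consists of the first `m` Taylor coefficients of `f`. [folklore] -/
theorem coeff_newtonPoly {R : K[X][Y]} {f : K[X]} (hR : R.eval f = 0) {δinv : K}
    (hδ : (derivative R).evalEval 0 (f.coeff 0) * δinv = 1) :
    ∀ (m i : ℕ), i < m → (newtonPoly R (f.coeff 0) δinv m).coeff i = f.coeff i := by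
  -- it suffices to treat the step at which coefficient `i` is set
  suffices h : ∀ i, (newtonPoly R (f.coeff 0) δinv (i + 1)).coeff i = f.coeff i by
    intro m i hi
    rw [coeff_newtonPoly_of_lt R _ _ hi, h i]
  intro i
  induction i using Nat.strong_induction_on with
  | _ i ih =>
    rw [coeff_newtonPoly_succ_self, newtonNext]
    rcases Nat.eq_zero_or_pos i with rfl | hi
    · rw [if_pos rfl]
    · rw [if_neg hi.ne']
      -- the partial polynomial `g_i` agrees with `f` below `i`
      have hg : ∀ k < i, (newtonPoly R (f.coeff 0) δinv i).coeff k = f.coeff k := fun k hk => by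
        rw [coeff_newtonPoly_of_lt R _ _ hk, ih k hk]
      have hstep := newton_step hi hR hg (degree_newtonPoly_lt R _ _ i)
      rw [← hstep, mul_assoc, hδ, mul_one]

/-- **The whole polynomial**: if moreover `deg f < n` then the `n`-th partial polynomial IS `f`.
[folklore] -/
theorem newtonPoly_eq {R : K[X][Y]} {f : K[X]} (hR : R.eval f = 0) {δinv : K}
    (hδ : (derivative R).evalEval 0 (f.coeff 0) * δinv = 1) {n : ℕ} (hf : f.degree < n) :
    newtonPoly R (f.coeff 0) δinv n = f := by
  ext i
  by_cases hi : i < n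
  · exact coeff_newtonPoly hR hδ n i hi
  · rw [coeff_eq_zero_of_degree_lt (lt_of_lt_of_le (degree_newtonPoly_lt R _ _ n) (by exact_mod_cast not_lt.1 hi)),
      coeff_eq_zero_of_degree_lt (lt_of_lt_of_le hf (by exact_mod_cast not_lt.1 hi))]

end Bivariate

end LDC

end Literature.Computability.MetaComplexity
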